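import Summits.Schanuel.Schanuel.Theorems.RootDecomp1KRadicalCells
import Mathlib.NumberTheory.MahlerMeasure

/-!
# RootDecomp1K — «GENERIC CELLS», addendum: the ENDGAME of Piece CF, PROVED (lens 6, gen 13; v2)

Kernel lemmas for steps (iv′), (iv), (v) of the proof plan of `CylinderFunnel` (memo NODE-g13 §3.4),
hypothesis-free (nothing is assumed about `u` or `e^u`):

* `kronecker_gap` — **Kronecker with a gap, uniform in bounded degree** (Northcott + Kronecker, both from
  Mathlib's `NumberTheory/MahlerMeasure`): for every `n` there is `η > 0` such that every non-zero `p ∈ ℤ[X]`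
  with `deg p ≤ n` and Mahler measure `M(p) < 1 + η` has all its non-zero complex roots roots of unity.
* `pow_torsionExponent_eq_one` — a root of unity that is a root of a non-zero `g ∈ ℤ[X]` with `deg g ≤ e`
  has order `< 2(e+1)²` (via the tree's `totient_le_natDegree_of_aeval_eq_zero`, `lt_totient_of_le`), hence
  satisfies `z ^ (2(e+1)²)! = 1` — ONE exponent for all of them.
* `pow_eq_one_of_forall_close` — a complex number arbitrarily close to `N`-th roots of unity is one.
* `cf_torsion_endgame` — step (v): if `e^u` and `e^{ρu}` (`u ≠ 0`, `ρ` hyper-Liouville) are both arbitrarily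
  close to `N`-th roots of unity, contradiction (`u ∈ 2πiℚ^×` forces `ρ ∈ ℚ`).
* (v2) `isIntegral_of_isIntegral_int_mul_pow` — **integrality of the Kummer generator**: in a number field
  of degree `≤ e`, `c·x^q ∈ 𝓞_K` with `c ∈ ℤ ∖ 0`, `|c|^e < 2^q` forces `x ∈ 𝓞_K` (finite places /
  Dedekind valuations: a denominator prime `𝔭` of `x` gives `𝔭^q ∣ (c)`, so `2^q ≤ N𝔭^q ≤ |c|^{[K:ℚ]}`).
* (v2) `exists_pow_eq_one_of_pow_aeval_eq_zero`, `cf_root_of_unity` — **step (iv′) in full**: `F ∈ ℤ[X]∖0`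
  with roots of modulus `≤ R`, `δ ≠ 0`, `F(δ^q) = 0`, `[ℚ(δ):ℚ] ≤ e`, `|lc F|^e < 2^q`, `R^e < (1+η(e))^q`
  ⟹ `δ` is a root of unity (`δ ∈ 𝓞`, `M(minpoly_ℤ δ) ≤ R^{e/q}`, Kronecker gap).

So after this file the open part of CF is exactly: roots (i), Liouville exactness `γ_q^q = y_q^p` (ii) and
the Kummer descent `δ^q = y_q, δ^p = γ_q, [ℚ(δ):ℚ] ≤ d_A d_B` (iii) of the memo — the transcendence-free
arithmetic tail (iv′)(iv)(v) is kernel.  Sorry-free; standard axioms; rung 0.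
-/

noncomputable section

open Complex Polynomial

namespace Summit.Schanuel.Schanuel.Theorems.RootDecomp1KGeneric

open Summit.Schanuel.Schanuel.Theorems.RootDecomp1KHyper.HyperCell (HyperLiouville HyperLiouville.irrational
  totient_le_natDegree_of_aeval_eq_zero lt_totient_of_le)

/-! ## 1. Kronecker with a gap -/

/-- **Kronecker's theorem with a GAP, uniform in bounded degree** (Northcott's finiteness + Kronecker):
for every `n` there is `η > 0` such that a non-zero integer polynomial of degree `≤ n` and Mahler measure
`< 1 + η` has only roots of unity (and `0`) as complex roots. -/
theorem kronecker_gap (n : ℕ) : ∃ η : ℝ, 0 < η ∧ ∀ p : ℤ[X], p ≠ 0 → p.natDegree ≤ n →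
    (p.map (Int.castRingHom ℂ)).mahlerMeasure < 1 + η →
    ∀ z : ℂ, z ≠ 0 → z ∈ p.aroots ℂ → ∃ k : ℕ, 0 < k ∧ z ^ k = 1 := by
  classical
  have hfin := Polynomial.finite_mahlerMeasure_le n 2
  set S : Finset ℤ[X] := hfin.toFinset with hS
  set T : Finset ℝ := (S.image fun p => (p.map (Int.castRingHom ℂ)).mahlerMeasure).filter
    (fun x => 1 < x) with hT
  obtain ⟨η, hη0, hη1, hηT⟩ : ∃ η : ℝ, 0 < η ∧ η ≤ 1 ∧ ∀ x ∈ T, η ≤ x - 1 := by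
    by_cases hTne : T.Nonempty
    · have hmin1 : 1 < T.min' hTne := (Finset.mem_filter.mp (T.min'_mem hTne)).2
      refine ⟨min 1 (T.min' hTne - 1), lt_min one_pos (by linarith), min_le_left _ _, ?_⟩
      intro x hx
      have : T.min' hTne ≤ x := T.min'_le x hx
      exact (min_le_right _ _).trans (by linarith)
    · exact ⟨1, one_pos, le_rfl, fun x hx => (hTne ⟨x, hx⟩).elim⟩
  refine ⟨η, hη0, fun p hp hdeg hM z hz0 hz => ?_⟩
  have hM1 : 1 ≤ (p.map (Int.castRingHom ℂ)).mahlerMeasure :=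
    Polynomial.one_le_mahlerMeasure_of_ne_zero hp
  have hpS : p ∈ S := by
    rw [hS, Set.Finite.mem_toFinset]
    refine ⟨hdeg, ?_⟩
    push_cast
    linarith
  have hMeq : (p.map (Int.castRingHom ℂ)).mahlerMeasure = 1 := by
    by_contra hne
    have hgt : 1 < (p.map (Int.castRingHom ℂ)).mahlerMeasure := lt_of_le_of_ne hM1 (Ne.symm hne)
    have hxT : (p.map (Int.castRingHom ℂ)).mahlerMeasure ∈ T :=
      Finset.mem_filter.mpr ⟨Finset.mem_image.mpr ⟨p, hpS, rfl⟩, hgt⟩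
    have := hηT _ hxT
    linarith
  exact Polynomial.pow_eq_one_of_mahlerMeasure_eq_one hMeq hz0 hz

/-! ## 2. Roots of unity of bounded degree have bounded order -/

/-- The uniform exponent: `N(e) = (2(e+1)²)!`. -/
def torsionExponent (e : ℕ) : ℕ := (2 * (e + 1) ^ 2).factorial

/-- `torsionExponent e` is positive. -/
theorem torsionExponent_pos (e : ℕ) : 0 < torsionExponent e := Nat.factorial_pos _

/-- A root of unity `z` (`z ^ k = 1`, `k > 0`) which is a root of a non-zero `g ∈ ℤ[X]` of degree `≤ e` has
order `< 2(e+1)²`; hence `z ^ N(e) = 1` with `N(e) = (2(e+1)²)!`. -/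
theorem pow_torsionExponent_eq_one {z : ℂ} {k : ℕ} (hk : 0 < k) (hzk : z ^ k = 1) {g : ℤ[X]} (hg : g ≠ 0)
    {e : ℕ} (hge : g.natDegree ≤ e) (hgz : aeval z g = 0) : z ^ torsionExponent e = 1 := by
  -- the exact order of z
  have hfin : IsOfFinOrder z := isOfFinOrder_iff_pow_eq_one.mpr ⟨k, hk, hzk⟩
  set q := orderOf z with hq
  have hq0 : 0 < q := hfin.orderOf_pos
  have hprim : IsPrimitiveRoot z q := IsPrimitiveRoot.orderOf z
  have htot : q.totient ≤ e := (totient_le_natDegree_of_aeval_eq_zero hq0 hprim hg hgz).trans hge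
  have hqlt : q < 2 * (e + 1) ^ 2 := by
    by_contra hle
    have := lt_totient_of_le (not_lt.mp hle)
    omega
  have hdvd : q ∣ torsionExponent e := Nat.dvd_factorial hq0 hqlt.le
  obtain ⟨c, hc⟩ := hdvd
  rw [hc, pow_mul, hq, pow_orderOf_eq_one, one_pow]

/-! ## 3. Closure: arbitrarily close to `N`-th roots of unity ⇒ an `N`-th root of unity -/

/-- If `x ∈ ℂ` is, for every `ε > 0`, within `ε` of some `w` with `w ^ N = 1` (`N > 0`), then `x ^ N = 1`. -/
theorem pow_eq_one_of_forall_close {x : ℂ} {N : ℕ} (hN : 0 < N)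
    (h : ∀ ε : ℝ, 0 < ε → ∃ w : ℂ, w ^ N = 1 ∧ ‖x - w‖ < ε) : x ^ N = 1 := by
  classical
  by_contra hx
  -- the finite set of N-th roots of unity
  set R : Finset ℂ := (Polynomial.nthRoots N (1 : ℂ)).toFinset with hR
  have hmem : ∀ w : ℂ, w ^ N = 1 → w ∈ R := by
    intro w hw
    rw [hR, Multiset.mem_toFinset, Polynomial.mem_nthRoots hN]
    exact hw
  have hxR : x ∉ R := by
    intro hxR
    rw [hR, Multiset.mem_toFinset, Polynomial.mem_nthRoots hN] at hxR
    exact hx hxR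
  have hRne : R.Nonempty := ⟨1, hmem 1 (one_pow _)⟩
  -- positive distance from x to R
  set D : Finset ℝ := R.image fun w => ‖x - w‖ with hD
  have hDne : D.Nonempty := hRne.image _
  set δ := D.min' hDne with hδ
  have hδpos : 0 < δ := by
    obtain ⟨w, hw, hwe⟩ := Finset.mem_image.mp (D.min'_mem hDne)
    rw [hδ, ← hwe]
    refine norm_pos_iff.mpr (sub_ne_zero.mpr ?_)
    rintro rfl
    exact hxR hw
  obtain ⟨w, hwN, hwx⟩ := h δ hδpos
  have hle : δ ≤ ‖x - w‖ := by
    rw [hδ]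
    exact D.min'_le _ (Finset.mem_image.mpr ⟨w, hmem w hwN, rfl⟩)
  linarith

/-! ## 4. Step (v) of CF: the torsion endgame -/

/-- `e^u` an `N`-th root of unity (`N > 0`) ⇒ `u = r · 2πi` with `r ∈ ℚ`. -/
theorem exists_rat_mul_twoPiI_of_exp_pow_eq_one {u : ℂ} {N : ℕ} (hN : 0 < N) (h : cexp u ^ N = 1) :
    ∃ r : ℚ, u = (r : ℂ) * (2 * Real.pi * I) := by
  rw [← Complex.exp_nat_mul, Complex.exp_eq_one_iff] at h
  obtain ⟨n, hn⟩ := h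
  refine ⟨(n : ℚ) / N, ?_⟩
  have hN' : (N : ℂ) ≠ 0 := by exact_mod_cast hN.ne'
  push_cast
  field_simp
  linear_combination hn

/-- **CF, step (v) — the torsion endgame (kernel, hypothesis-free).**  If `u ≠ 0`, `ρ` is hyper-Liouville, and
both `e^u` and `e^{ρu}` are arbitrarily close to `N`-th roots of unity (`N > 0` fixed), contradiction:
`e^u, e^{ρu} ∈ μ_N` forces `u ∈ 2πiℚ^×` and then `ρ ∈ ℚ`. -/
theorem cf_torsion_endgame {u : ℂ} (hu0 : u ≠ 0) {ρ : ℝ} (hρ : HyperLiouville ρ) {N : ℕ} (hN : 0 < N)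
    (hy : ∀ ε : ℝ, 0 < ε → ∃ w : ℂ, w ^ N = 1 ∧ ‖cexp u - w‖ < ε)
    (ht : ∀ ε : ℝ, 0 < ε → ∃ w : ℂ, w ^ N = 1 ∧ ‖cexp (u * ρ) - w‖ < ε) : False := by
  obtain ⟨r, hr⟩ := exists_rat_mul_twoPiI_of_exp_pow_eq_one hN (pow_eq_one_of_forall_close hN hy)
  obtain ⟨s, hs⟩ := exists_rat_mul_twoPiI_of_exp_pow_eq_one hN (pow_eq_one_of_forall_close hN ht)
  have h2pi : (2 * Real.pi * I : ℂ) ≠ 0 := by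
    have : (Real.pi : ℂ) ≠ 0 := by exact_mod_cast Real.pi_ne_zero
    simp [this, I_ne_zero]
  have hr0 : (r : ℂ) ≠ 0 := by
    rintro h0
    apply hu0
    rw [hr, h0, zero_mul]
  -- ρ = s / r
  have hρeq : (ρ : ℂ) = (s : ℂ) / (r : ℂ) := by
    have h1 : (r : ℂ) * (2 * Real.pi * I) * (ρ : ℂ) = (s : ℂ) * (2 * Real.pi * I) := by
      rw [← hr, ← hs]
    field_simp
    have := mul_right_cancel₀ h2pi (by
      calc (ρ : ℂ) * (r : ℂ) * (2 * Real.pi * I) = (r : ℂ) * (2 * Real.pi * I) * (ρ : ℂ) := by ring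
        _ = (s : ℂ) * (2 * Real.pi * I) := h1)
    linear_combination this
  have hρrat : ρ = ((s / r : ℚ) : ℝ) := by
    have : ((ρ : ℝ) : ℂ) = (((s / r : ℚ) : ℝ) : ℂ) := by
      rw [hρeq]; push_cast; rfl
    exact_mod_cast this
  exact (HyperLiouville.irrational hρ) ⟨s / r, hρrat.symm⟩

/-! ## CF step (iv′): integrality of the Kummer generator and the root-of-unity criterion

The two arithmetic lemmas that turn the output of steps (i)–(iii) of the `CylinderFunnel` plan
(an algebraic `δ ≠ 0` of bounded degree with `A_q(δ^q) = 0`, `lc(A_q) ≤ q^C`, roots of `A_q`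
bounded) into "`δ` is a root of unity", with NO hypothesis on `u`:
* `isIntegral_of_isIntegral_int_mul_pow` — in a number field of degree `≤ e`, `c·x^q ∈ 𝓞`
  with `|c|^e < 2^q` forces `x ∈ 𝓞` (finite places: a denominator prime `𝔭` of `x` would give
  `𝔭^q ∣ (c)`, so `2^q ≤ N𝔭^q ≤ |c|^{[K:ℚ]}`);
* `exists_pow_eq_one_of_pow_aeval_eq_zero` — then `M(minpoly_ℤ δ) ≤ R^{e/q} < 1 + η(e)` and the
  Kronecker gap applies; `cf_root_of_unity` packages it with `kronecker_gap`. -/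

section Integrality

open NumberField IsDedekindDomain WithZero

/-- **Integrality from a bounded-degree `q`-th root.**  In a number field `K` of degree `≤ e`: if
`c · x^q` is an algebraic integer (`c ∈ ℤ ∖ 0`) and `|c|^e < 2^q`, then `x` is an algebraic integer.
(Valuations: a prime `𝔭` in the denominator of `x` would give `𝔭^q ∣ (c)`, so `2^q ≤ N𝔭^q ≤ |c|^{[K:ℚ]}`.) -/
theorem isIntegral_of_isIntegral_int_mul_pow {K : Type*} [Field K] [NumberField K] {x : K} {q e : ℕ}
    {c : ℤ} (hc : c ≠ 0) (hint : IsIntegral ℤ ((c : K) * x ^ q))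
    (hdeg : Module.finrank ℚ K ≤ e) (hsmall : c.natAbs ^ e < 2 ^ q) : IsIntegral ℤ x := by
  classical
  suffices h : ∀ v : HeightOneSpectrum (𝓞 K), v.valuation K x ≤ 1 by
    obtain ⟨y, hy⟩ := HeightOneSpectrum.mem_integers_of_valuation_le_one (R := 𝓞 K) K x h
    rw [← hy]
    exact RingOfIntegers.isIntegral_coe y
  intro v
  by_contra hv
  have hv' : 1 < v.valuation K x := not_le.mp hv
  set w := v.valuation K x with hw
  have hw0 : w ≠ 0 := (lt_trans zero_lt_one hv').ne'
  -- the algebraic integer r = c * x^q and the integer c inside 𝓞 K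
  set r : 𝓞 K := ⟨(c : K) * x ^ q, hint⟩ with hr
  have hc' : ((c : 𝓞 K) : K) = (c : K) := rfl
  have hcO : (c : 𝓞 K) ≠ 0 := by exact_mod_cast hc
  -- valuations
  have hval_r : v.valuation K ((c : K) * x ^ q) ≤ 1 := by
    have := v.valuation_le_one (K := K) r
    simpa [hr] using this
  have hval_c : v.valuation K (c : K) = v.intValuation (c : 𝓞 K) := by
    rw [← hc']
    exact v.valuation_of_algebraMap (K := K) (c : 𝓞 K)
  set u₀ := v.intValuation (c : 𝓞 K) with hu₀
  have hu0 : u₀ ≠ 0 := v.intValuation_ne_zero _ hcO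
  have hprod : u₀ * w ^ q ≤ 1 := by
    have : v.valuation K ((c : K) * x ^ q) = u₀ * w ^ q := by
      rw [map_mul, map_pow, hval_c]
    rw [← this]; exact hval_r
  -- logs
  have hlogw : 0 < WithZero.log w := by
    have := (WithZero.log_lt_log one_ne_zero hw0).mpr hv'
    simpa using this
  have hwq0 : w ^ q ≠ 0 := pow_ne_zero _ hw0
  have hlog : WithZero.log u₀ + q • WithZero.log w ≤ 0 := by
    have h1 : WithZero.log (u₀ * w ^ q) ≤ WithZero.log (1 : ℤᵐ⁰) :=
      (WithZero.log_le_log (mul_ne_zero hu0 hwq0) one_ne_zero).mpr hprod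
    rwa [WithZero.log_mul hu0 hwq0, WithZero.log_pow, WithZero.log_one] at h1
  have hlogu : WithZero.log u₀ ≤ -(q : ℤ) := by
    have : (q : ℤ) ≤ q • WithZero.log w := by
      rw [nsmul_eq_mul]
      nlinarith
    linarith
  have hule : u₀ ≤ WithZero.exp (-(q : ℤ)) := WithZero.le_exp_of_log_le hlogu
  -- 𝔭^q ∣ (c)
  have hdvd : v.asIdeal ^ q ∣ Ideal.span {(c : 𝓞 K)} :=
    (v.intValuation_le_pow_iff_dvd (c : 𝓞 K) q).mp hule
  -- norms
  have hN := map_dvd Ideal.absNorm hdvd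
  rw [map_pow, Ideal.absNorm_span_singleton] at hN
  have hnorm : (Algebra.norm ℤ (c : 𝓞 K)).natAbs = c.natAbs ^ Module.finrank ℚ K := by
    have h1 : Algebra.norm ℤ ((algebraMap ℤ (𝓞 K)) c) = c ^ Module.finrank ℤ (𝓞 K) :=
      Algebra.norm_algebraMap c
    rw [RingOfIntegers.rank] at h1
    rw [show (c : 𝓞 K) = algebraMap ℤ (𝓞 K) c from (eq_intCast _ c).symm, h1, Int.natAbs_pow]
  rw [hnorm] at hN
  -- absNorm 𝔭 ≥ 2
  have hN2 : 2 ≤ Ideal.absNorm v.asIdeal := by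
    have h0 : Ideal.absNorm v.asIdeal ≠ 0 := by
      rw [Ne, Ideal.absNorm_eq_zero_iff]
      exact v.ne_bot
    have h1 : Ideal.absNorm v.asIdeal ≠ 1 := by
      rw [Ne, Ideal.absNorm_eq_one_iff]
      exact v.isPrime.ne_top
    omega
  have hcpos : 1 ≤ c.natAbs := Int.natAbs_pos.mpr hc
  have hle : Ideal.absNorm v.asIdeal ^ q ≤ c.natAbs ^ Module.finrank ℚ K :=
    Nat.le_of_dvd (pow_pos (by omega) _) hN
  have hle2 : c.natAbs ^ Module.finrank ℚ K ≤ c.natAbs ^ e := Nat.pow_le_pow_right hcpos hdeg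
  have h2q : 2 ^ q ≤ Ideal.absNorm v.asIdeal ^ q := Nat.pow_le_pow_left hN2 q
  omega


/-- **Root-of-unity criterion (CF step (iv′)).**  Let `F ∈ ℤ[X] ∖ 0` have all complex roots of
modulus `≤ R` (`R ≥ 1`), and let `δ ≠ 0` with `F(δ^q) = 0`, `[ℚ(δ):ℚ] ≤ e`.  If
`|lc F|^e < 2^q` and `R^e < (1+η)^q`, where `η = η(e) > 0` is a Kronecker gap in degree `≤ e`
(`hK`, supplied by `kronecker_gap e`), then `δ` is a root of unity.  (Integrality of `δ` by
`isIntegral_of_isIntegral_int_mul_pow`; then `M(minpoly_ℤ δ) ≤ R^{e/q} < 1 + η`.) -/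
theorem exists_pow_eq_one_of_pow_aeval_eq_zero {e : ℕ} {η : ℝ} (hη : 0 < η)
    (hK : ∀ p : ℤ[X], p ≠ 0 → p.natDegree ≤ e → (p.map (Int.castRingHom ℂ)).mahlerMeasure < 1 + η →
      ∀ z : ℂ, z ≠ 0 → z ∈ p.aroots ℂ → ∃ k : ℕ, 0 < k ∧ z ^ k = 1)
    {F : ℤ[X]} (hF : F ≠ 0) {R : ℝ} (hR : 1 ≤ R) (hroots : ∀ z ∈ F.aroots ℂ, ‖z‖ ≤ R)
    {q : ℕ} (hq : 0 < q) {δ : ℂ} (hδ0 : δ ≠ 0) (hδ : aeval (δ ^ q) F = 0)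
    (hdeg : (minpoly ℚ δ).natDegree ≤ e) (hlc : F.leadingCoeff.natAbs ^ e < 2 ^ q)
    (hsmall : R ^ e < (1 + η) ^ q) : ∃ k : ℕ, 0 < k ∧ δ ^ k = 1 := by
  classical
  -- δ is a root of the nonzero integer polynomial `expand ℤ q F`
  have hexp : aeval δ (expand ℤ q F) = 0 := by rw [expand_aeval]; exact hδ
  have hexp0 : expand ℤ q F ≠ 0 := by rwa [Ne, expand_eq_zero hq]
  have hFC : F.map (Int.castRingHom ℂ) ≠ 0 := by
    simpa using (Polynomial.map_injective (Int.castRingHom ℂ) Int.cast_injective).ne hF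
  -- δ is integral over ℚ
  have hδQ : IsIntegral ℚ δ := by
    have halg : IsAlgebraic ℤ δ := ⟨expand ℤ q F, hexp0, hexp⟩
    exact (halg.extendScalars (R := ℤ) (S := ℚ) (algebraMap ℤ ℚ).injective_int).isIntegral
  -- the number field K = ℚ(δ) and the element x = δ ∈ K
  set K := IntermediateField.adjoin ℚ ({δ} : Set ℂ) with hKdef
  haveI : FiniteDimensional ℚ K := IntermediateField.adjoin.finiteDimensional hδQ
  haveI : NumberField K := NumberField.mk
  set x : K := IntermediateField.AdjoinSimple.gen ℚ δ with hxdef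
  have hxδ : algebraMap K ℂ x = δ := IntermediateField.AdjoinSimple.algebraMap_gen ℚ δ
  have hinjK : Function.Injective (algebraMap K ℂ) := (algebraMap K ℂ).injective
  have hrank : Module.finrank ℚ K ≤ e := by
    rw [hKdef, IntermediateField.adjoin.finrank hδQ]; exact hdeg
  -- integrality of lc(F) · δ^q, transported to K
  set c : ℤ := F.leadingCoeff with hcdef
  have hc : c ≠ 0 := leadingCoeff_ne_zero.mpr hF
  have hintC : IsIntegral ℤ ((c : ℂ) * δ ^ q) := by
    have := isIntegral_leadingCoeff_smul (R := ℤ) (p := F) (x := δ ^ q) hδ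
    simpa [Algebra.smul_def] using this
  have hintK : IsIntegral ℤ ((c : K) * x ^ q) := by
    rw [← isIntegral_algebraMap_iff hinjK (R := ℤ)]
    simpa [map_mul, map_pow, hxδ] using hintC
  have hlc' : c.natAbs ^ e < 2 ^ q := hlc
  have hxint : IsIntegral ℤ x := isIntegral_of_isIntegral_int_mul_pow hc hintK hrank hlc'
  have hδint : IsIntegral ℤ δ := by rw [← hxδ]; exact hxint.algebraMap
  -- the integer minimal polynomial g of δ
  set g : ℤ[X] := minpoly ℤ δ with hgdef
  have hgm : g.Monic := minpoly.monic hδint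
  have hg0 : g ≠ 0 := hgm.ne_zero
  have hgdvd : g ∣ expand ℤ q F := minpoly.isIntegrallyClosed_dvd hδint hexp
  have hgdeg : g.natDegree ≤ e := by
    have h1 : minpoly ℚ δ = g.map (algebraMap ℤ ℚ) :=
      minpoly.isIntegrallyClosed_eq_field_fractions' ℚ hδint
    have h2 : (g.map (algebraMap ℤ ℚ)).natDegree = g.natDegree := hgm.natDegree_map _
    rw [← h2, ← h1]; exact hdeg
  -- roots of g in ℂ have modulus^q ≤ R
  set G := g.map (Int.castRingHom ℂ) with hGdef
  have hGm : G.Monic := hgm.map _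
  have hroot_bound : ∀ α ∈ G.roots, (max 1 ‖α‖) ^ q ≤ R := by
    intro α hα
    have hα' : aeval α g = 0 := (mem_aroots.mp hα).2
    have hαF : aeval (α ^ q) F = 0 := by
      obtain ⟨r, hr⟩ := hgdvd
      have : aeval α (expand ℤ q F) = 0 := by rw [hr, map_mul, hα', zero_mul]
      rwa [expand_aeval] at this
    have hmem : α ^ q ∈ F.aroots ℂ := mem_aroots.mpr ⟨hF, hαF⟩
    have hb : ‖α‖ ^ q ≤ R := by simpa [norm_pow] using hroots _ hmem
    rcases le_or_gt ‖α‖ 1 with h1 | h1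
    · rw [max_eq_left h1, one_pow]; exact hR
    · rw [max_eq_right h1.le]; exact hb
  -- Mahler measure of G
  have hcard : Multiset.card G.roots ≤ e := (card_roots' G).trans (by
    rw [hGdef, hgm.natDegree_map]; exact hgdeg)
  set P := (G.roots.map (fun a ↦ max 1 ‖a‖)).prod with hPdef
  have hP0 : 0 ≤ P := Multiset.prod_nonneg (fun a ha ↦ by
    obtain ⟨b, _, rfl⟩ := Multiset.mem_map.mp ha; positivity)
  have hPq : P ^ q ≤ R ^ e := by
    have h1 : P ^ q = (G.roots.map (fun a ↦ (max 1 ‖a‖) ^ q)).prod := by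
      rw [hPdef, Multiset.prod_map_pow]
    have h2 : (G.roots.map (fun a ↦ (max 1 ‖a‖) ^ q)).prod ≤ (G.roots.map (fun _ ↦ R)).prod :=
      Multiset.prod_map_le_prod_map₀ _ _ (fun a _ ↦ by positivity) (fun a ha ↦ hroot_bound a ha)
    have h3 : (G.roots.map (fun _ ↦ R)).prod = R ^ Multiset.card G.roots := by
      rw [Multiset.map_const', Multiset.prod_replicate]
    rw [h1]; refine h2.trans ?_; rw [h3]
    exact pow_le_pow_right₀ hR hcard
  have hPlt : P < 1 + η := by
    by_contra hcon
    have hge : 1 + η ≤ P := not_lt.mp hcon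
    have : (1 + η) ^ q ≤ P ^ q := pow_le_pow_left₀ (by linarith) hge q
    linarith
  have hM : G.mahlerMeasure < 1 + η := by
    rw [mahlerMeasure_eq_leadingCoeff_mul_prod_roots, hGm.leadingCoeff, norm_one, one_mul]
    exact hPlt
  -- conclude by the Kronecker gap
  have hδroot : δ ∈ g.aroots ℂ := mem_aroots.mpr ⟨hg0, minpoly.aeval ℤ δ⟩
  exact hK g hg0 hgdeg hM δ hδ0 hδroot

/-- **CF step (iv′), packaged.**  For every degree bound `e` there is `η > 0` such that: whenever
`F ∈ ℤ[X] ∖ 0` has complex roots of modulus `≤ R` (`R ≥ 1`), `δ ≠ 0`, `F(δ^q) = 0`,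
`[ℚ(δ):ℚ] ≤ e`, `|lc F|^e < 2^q` and `R^e < (1+η)^q`, the number `δ` is a root of unity. -/
theorem cf_root_of_unity (e : ℕ) : ∃ η : ℝ, 0 < η ∧
    ∀ (F : ℤ[X]), F ≠ 0 → ∀ (R : ℝ), 1 ≤ R → (∀ z ∈ F.aroots ℂ, ‖z‖ ≤ R) →
    ∀ (q : ℕ), 0 < q → ∀ (δ : ℂ), δ ≠ 0 → aeval (δ ^ q) F = 0 →
    (minpoly ℚ δ).natDegree ≤ e → F.leadingCoeff.natAbs ^ e < 2 ^ q → R ^ e < (1 + η) ^ q →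
    ∃ k : ℕ, 0 < k ∧ δ ^ k = 1 := by
  obtain ⟨η, hη, hK⟩ := kronecker_gap e
  exact ⟨η, hη, fun F hF R hR hroots q hq δ hδ0 hδ hdeg hlc hsmall ↦
    exists_pow_eq_one_of_pow_aeval_eq_zero hη hK hF hR hroots hq hδ0 hδ hdeg hlc hsmall⟩

end Integrality

end Summit.Schanuel.Schanuel.Theorems.RootDecomp1KGeneric
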